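import Literature.NumberTheory.Sieve.FGKMT2018Prop91MainTermL84
import Literature.NumberTheory.Sieve.FGKMT2018Prop91Assembly
import HarnessLib

/-!
# Maynard's Proposition 9.4: the `k`-dimensional sum `S_A` via Lemma 8.4

Source: J. Maynard, *Dense clusters of primes in subsets*, Compositio Math. 152 (2016) =
arXiv:1405.2593 [Maynard2016DenseClusters], proof of Proposition 9.4 p. 26 («the second sum is
`O(𝔖_{WB}(𝓛)^{-1})` times … by Lemma 8.4»), Lemma 8.4 p. 16.

After the `(k+1)`-dimensional diagonalisation (`Maynard2016Prop94QuadFormBound.abs_quadFormPlus_le`)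
the main term of Proposition 9.4 is controlled by the `k`-dimensional sum
`S_A = ∑_{g ∈ 𝒟_k(𝓛)} (y_g/φ_ω(g))² (∏_{p∣g}(1 + 2/(p−1)))² ∏_{p∣g}(p + 4k + 3) = ∑_g y_g²/∏_{p∣g} A₃(p)`
with the multiplicative weight `A₃(p) = (p − ω(p))²(p − 1)²/((p + 1)²(p + 4k + 3))` (§1–§2). As in the
proof of (9.4) (`FGKMT2018Prop91MainTermL84`), `S_A = P² Σ^{(k)}(W_j; A₃; ψ², g_k²)` is an `r`-fold sum of
Lemma 8.4 (§3); the Euler products compare, `Π_{A₃} ≤ 4⁹⁰ Π` (§4); and one application of the decoupled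
Lemma 8.4 in the frame of Proposition 6.1 gives **`prop94_kdimSum_frame`**:
`S_A ≤ K · P · (log R)^k I_k(F)` with `P = (WB)^k 𝔖_{WB}(𝓛)/φ(WB)^k` (§5) — i.e. `S_A ≪ y_max² (log R)^k/𝔖_{WB}`
up to the normalisation of `F`, as printed.

## References
* J. Maynard, *Dense clusters of primes in subsets*, Compositio Math. 152 (2016), Prop. 9.4 with proof
  pp. 25–26, Lemma 8.4 p. 16, proof of Prop. 9.1 (9.4) p. 20 [Maynard2016DenseClusters].
* K. Ford, B. Green, S. Konyagin, J. Maynard, T. Tao, *Long gaps between primes*, JAMS 31 (2018), Thm 6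
  pp. 21–22 [FordGreenKonyaginMaynardTao2018].
-/

open Finset Filter Real
open scoped Topology

namespace Literature.NumberTheory.Sieve.FGKMT2018

variable {k : ℕ}

/-! ## §1 The multiplicative weight `A₃(p) = (p − ω(p))²(p − 1)²/((p + 1)²(p + 4k + 3))` -/

/-- `A₃(p) = (p − ω_𝓛(p))²(p − 1)²/((p + 1)²(p + 4k + 3))`: the function `g` of Lemma 8.4 for which
`1/∏_{p∣m} g(p)` is the weight `φ_ω(m)^{-2} (∏_{p∣m}(p+1)/(p−1))² ∏_{p∣m}(p + 4k + 3)` of `S_A`.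
[cite: Maynard2016DenseClusters, proof of Prop. 9.4 p. 26 («by Lemma 8.4»), Lemma 8.4 (8.9)] -/
noncomputable def a3Fun (L : Fin k → ℤ × ℤ) (p : ℕ) : ℝ :=
  ((p : ℝ) - omegaL L p) ^ 2 * ((p : ℝ) - 1) ^ 2 / (((p : ℝ) + 1) ^ 2 * ((p : ℝ) + 4 * k + 3))

/-- `A₃(p) ≥ 0`. [cite: Maynard2016DenseClusters, proof of Prop. 9.4 p. 26] -/
theorem a3Fun_nonneg (L : Fin k → ℤ × ℤ) (p : ℕ) : 0 ≤ a3Fun L p := by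
  unfold a3Fun; positivity

/-- `A₃(p) > 0` at primes, for admissible `𝓛` (`ω(p) < p`). [cite: Maynard2016DenseClusters, §7 p. 13, proof of Prop. 9.4 p. 26] -/
theorem a3Fun_pos {L : Fin k → ℤ × ℤ} (hadm : FormsAdmissible L) {p : ℕ} (hp : p.Prime) :
    0 < a3Fun L p := by
  have h1 := sub_omegaL_pos hadm hp
  have hp2 : (2 : ℝ) ≤ p := by exact_mod_cast hp.two_le
  unfold a3Fun
  have h2 : (0 : ℝ) < (p : ℝ) - 1 := by linarith
  positivity

/-- `A₃(p) ≤ p`. [cite: Maynard2016DenseClusters, Lemma 8.3/8.4 (hypothesis g(p) = p + O(k))] -/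
theorem a3Fun_le {L : Fin k → ℤ × ℤ} (hadm : FormsAdmissible L) {p : ℕ} (hp : p.Prime) :
    a3Fun L p ≤ p := by
  have hω0 : (0 : ℝ) ≤ (omegaL L p : ℕ) := Nat.cast_nonneg _
  have hω1 := sub_omegaL_pos hadm hp
  have hp2 : (2 : ℝ) ≤ p := by exact_mod_cast hp.two_le
  have hk0 : (0 : ℝ) ≤ k := Nat.cast_nonneg k
  unfold a3Fun
  rw [div_le_iff₀ (by positivity)]
  have h1 : ((p : ℝ) - omegaL L p) ^ 2 ≤ (p : ℝ) ^ 2 := by nlinarith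
  have h2 : ((p : ℝ) - 1) ^ 2 ≤ ((p : ℝ) + 1) ^ 2 := by nlinarith
  calc ((p : ℝ) - omegaL L p) ^ 2 * ((p : ℝ) - 1) ^ 2 ≤ (p : ℝ) ^ 2 * ((p : ℝ) + 1) ^ 2 :=
        mul_le_mul h1 h2 (sq_nonneg _) (sq_nonneg _)
    _ = (p : ℝ) * (((p : ℝ) + 1) ^ 2 * p) := by ring
    _ ≤ (p : ℝ) * (((p : ℝ) + 1) ^ 2 * ((p : ℝ) + 4 * k + 3)) := by
        apply mul_le_mul_of_nonneg_left _ (by linarith)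
        exact mul_le_mul_of_nonneg_left (by linarith) (sq_nonneg _)

/-- `p − A₃(p) ≤ 6k + 7` at primes, for admissible `𝓛` (`ω(p) ≤ k`): the deviation `g(p) = p + O(k)`.
[cite: Maynard2016DenseClusters, Lemma 8.3/8.4 (hypothesis g(p) = p + O(k)), §7 p. 13 (ω(p) ≤ k)] -/
theorem sub_a3Fun_le {L : Fin k → ℤ × ℤ} (hadm : FormsAdmissible L) {p : ℕ} (hp : p.Prime) :
    (p : ℝ) - a3Fun L p ≤ 6 * k + 7 := by
  have h0 := a3Fun_nonneg L p
  rcases le_or_gt (p : ℝ) (6 * k + 7) with hle | hlt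
  · linarith
  have hω : ((omegaL L p : ℕ) : ℝ) ≤ k := by exact_mod_cast omegaL_le_card_of_admissible hadm hp
  have hω0 : (0 : ℝ) ≤ (omegaL L p : ℕ) := Nat.cast_nonneg _
  have hk0 : (0 : ℝ) ≤ k := Nat.cast_nonneg k
  have hp2 : (2 : ℝ) ≤ p := by exact_mod_cast hp.two_le
  have hpk : (k : ℝ) ≤ p := by linarith
  -- `A₃ ≥ (p − k)²(p − 1)²/((p + 1)²(p + 4k + 3)) ≥ p − 6k − 7`
  have hD : (0 : ℝ) < ((p : ℝ) + 1) ^ 2 * ((p : ℝ) + 4 * k + 3) := by positivity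
  have h1 : ((p : ℝ) - k) ^ 2 * ((p : ℝ) - 1) ^ 2 ≤ ((p : ℝ) - omegaL L p) ^ 2 * ((p : ℝ) - 1) ^ 2 := by
    apply mul_le_mul_of_nonneg_right _ (sq_nonneg _)
    have : (p : ℝ) - k ≤ (p : ℝ) - omegaL L p := by linarith
    exact pow_le_pow_left₀ (by linarith) this 2
  have hid : ((p : ℝ) - k) ^ 2 * ((p : ℝ) - 1) ^ 2 -
      ((p : ℝ) - 6 * k - 7) * (((p : ℝ) + 1) ^ 2 * ((p : ℝ) + 4 * k + 3)) =
      (25 * (k : ℝ) ^ 2 + 54 * k + 29) * (p : ℝ) ^ 2 + (46 * (k : ℝ) ^ 2 + 92 * k + 46) * p +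
        (25 * (k : ℝ) ^ 2 + 46 * k + 21) := by ring
  have h2 : ((p : ℝ) - 6 * k - 7) * (((p : ℝ) + 1) ^ 2 * ((p : ℝ) + 4 * k + 3)) ≤
      ((p : ℝ) - k) ^ 2 * ((p : ℝ) - 1) ^ 2 := by
    have : 0 ≤ (25 * (k : ℝ) ^ 2 + 54 * k + 29) * (p : ℝ) ^ 2 + (46 * (k : ℝ) ^ 2 + 92 * k + 46) * p +
        (25 * (k : ℝ) ^ 2 + 46 * k + 21) := by positivity
    linarith
  have h3 : (p : ℝ) - 6 * k - 7 ≤ a3Fun L p := by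
    unfold a3Fun
    rw [le_div_iff₀ hD]
    exact h2.trans h1
  linarith

/-- `|1 + A₃(p) − p| + k ≤ k²` at primes (`k ≥ 8`): the hypothesis `K₁ ≤ K₀²` of the decoupled Lemma 8.4
with `K₀ = k`, `K₁ = k²`. [cite: Maynard2016DenseClusters, Lemma 8.3/8.4 (hypothesis g(p) = p + O(k)), proof of Prop. 9.4 p. 26] -/
theorem abs_one_add_a3Fun_sub_le (hk : 8 ≤ k) {L : Fin k → ℤ × ℤ} (hadm : FormsAdmissible L) {p : ℕ}
    (hp : p.Prime) : |1 + a3Fun L p - p| + (k : ℝ) ≤ (k : ℝ) ^ 2 := by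
  have hk' : (8 : ℝ) ≤ k := by exact_mod_cast hk
  have h1 := a3Fun_le hadm hp
  have h2 := sub_a3Fun_le hadm hp
  have habs : |1 + a3Fun L p - p| ≤ 6 * k + 6 := by
    rw [abs_le]; constructor <;> linarith
  nlinarith

/-! ## §2 `1/∏_{p∣m} A₃(p)` is the weight of `S_A` -/

/-- At a prime `p` with `ω(p) < p`: `A₃(p)⁻¹ = (p − ω(p))⁻² (1 + 2/(p−1))² (p + 4(k+1) − 1)`.
[cite: Maynard2016DenseClusters, proof of Prop. 9.4 p. 26] -/
theorem inv_a3Fun_eq {L : Fin k → ℤ × ℤ} (hadm : FormsAdmissible L) {p : ℕ} (hp : p.Prime) :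
    (a3Fun L p)⁻¹ =
      (((p : ℝ) - omegaL L p) ^ 2)⁻¹ * (1 + 2 / ((p : ℝ) - 1)) ^ 2 * ((p : ℝ) + 4 * ((k : ℝ) + 1) - 1) := by
  have h1 := sub_omegaL_pos hadm hp
  have hp2 : (2 : ℝ) ≤ p := by exact_mod_cast hp.two_le
  have hk0 : (0 : ℝ) ≤ k := Nat.cast_nonneg k
  have h2 : (p : ℝ) - 1 ≠ 0 := by
    have : (0 : ℝ) < (p : ℝ) - 1 := by linarith
    exact this.ne'
  have h3 : (p : ℝ) + 1 ≠ 0 := by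
    have : (0 : ℝ) < (p : ℝ) + 1 := by linarith
    exact this.ne'
  have h4 : (p : ℝ) + 4 * k + 3 ≠ 0 := by
    have : (0 : ℝ) < (p : ℝ) + 4 * k + 3 := by linarith
    exact this.ne'
  have h5 : 1 + 2 / ((p : ℝ) - 1) = ((p : ℝ) + 1) / ((p : ℝ) - 1) := by
    field_simp; ring
  rw [a3Fun, h5, inv_div]
  field_simp
  ring

/-- On `𝒟_k(𝓛)` the Lemma-8.4 weight for `A₃` is the `S_A` weight
`φ_ω(∏e)^{-2} (∏_{p∣∏e}(1 + 2/(p−1)))² ∏_{p∣∏e}(p + 4(k+1) − 1)`; off `𝒟_k(𝓛)` (inside the box) it vanishes.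
[cite: Maynard2016DenseClusters, proof of Prop. 9.4 p. 26, Lemma 8.4 (8.9)] -/
theorem rWeight_a3Fun_eq {L : Fin k → ℤ × ℤ} (hadm : FormsAdmissible L) {B : ℕ} {R : ℝ} {e : Fin k → ℕ}
    (he : e ∈ Fintype.piFinset fun _ : Fin k => Finset.Icc 1 ⌊R⌋₊) :
    MaynardDense.rWeight k (idxMod L B R) (a3Fun L) e =
      if e ∈ dkBox L B R then
        ((phiOmega L (∏ i, e i)) ^ 2)⁻¹ *
          (∏ p ∈ (∏ i, e i).primeFactors, (1 + 2 / ((p : ℝ) - 1))) ^ 2 *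
          ∏ p ∈ (∏ i, e i).primeFactors, ((p : ℝ) + 4 * ((k : ℝ) + 1) - 1) else 0 := by
  classical
  unfold MaynardDense.rWeight
  by_cases h : e ∈ dkBox L B R
  · rw [if_pos ((mem_dkBox_iff_coprime_idxMod he).1 h), if_pos h, phiOmega, ← Finset.prod_pow,
      ← Finset.prod_inv_distrib, ← Finset.prod_inv_distrib, ← Finset.prod_pow, ← Finset.prod_mul_distrib,
      ← Finset.prod_mul_distrib]
    exact Finset.prod_congr rfl fun p hp => inv_a3Fun_eq hadm (Nat.prime_of_mem_primeFactors hp)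
  · rw [if_neg (fun h' => h ((mem_dkBox_iff_coprime_idxMod he).2 h')), if_neg h]

/-! ## §3 `S_A` as an `r`-fold sum of Lemma 8.4 -/

/-- **`S_A = P² · Σ^{(k)}(W_j; A₃; ψ², g_k²)(R)`**: the `k`-dimensional sum of the proof of Prop. 9.4 is
an `r`-fold sum (8.9) of Lemma 8.4 with `Φ = ψ²`, `G = g_k²`, `g = A₃`, times
`P² = ((WB)^k 𝔖_{WB}(𝓛)/φ(WB)^k)²` (`k ≥ 2`, `R > 1`).
[cite: Maynard2016DenseClusters, proof of Prop. 9.4 p. 26 («by Lemma 8.4»), proof of Prop. 9.1 (9.4) p. 20] -/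
theorem sum_SA_eq_rFoldSum (hk : 2 ≤ k) {L : Fin k → ℤ × ℤ} (hadm : FormsAdmissible L) (B : ℕ) {R : ℝ}
    (hR : 1 < R) :
    ∑ g ∈ dkBox L B R,
        (yVar L B R (MaynardDense.F k) g / phiOmega L (∏ i, g i)) ^ 2 *
          (∏ p ∈ (∏ j, g j).primeFactors, (1 + 2 / ((p : ℝ) - 1))) ^ 2 *
          ∏ p ∈ (∏ j, g j).primeFactors, ((p : ℝ) + 4 * ((k : ℝ) + 1) - 1) =
      (((wCut k B * B : ℕ) : ℝ) ^ k / (Nat.totient (wCut k B * B) : ℝ) ^ k *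
          singSeriesExcl L (wCut k B * B)) ^ 2 *
        MaynardDense.rFoldSum k (idxMod L B R) (a3Fun L)
          (fun x => MaynardDense.psi x ^ 2) (fun t => MaynardDense.profExt k t ^ 2) R 0 := by
  classical
  set P : ℝ := ((wCut k B * B : ℕ) : ℝ) ^ k / (Nat.totient (wCut k B * B) : ℝ) ^ k *
    singSeriesExcl L (wCut k B * B) with hP
  have hG1 : ∀ t : ℝ, 1 ≤ t → MaynardDense.profExt k t ^ 2 = 0 := fun t ht => by
    rw [MaynardDense.profExt_eq_zero_of_one_le hk ht]; ring
  rw [← MaynardDense.sum_piFinset_Icc_eq_rFoldSum k (idxMod L B R) _ _ hG1 hR 0, Finset.mul_sum]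
  have hrw : ∀ e ∈ Fintype.piFinset (fun _ : Fin k => Finset.Icc 1 ⌊R⌋₊),
      P ^ 2 * (MaynardDense.rWeight k (idxMod L B R) (a3Fun L) e *
        ((fun x => MaynardDense.psi x ^ 2) (0 + ∑ i, MaynardDense.uOf R (e i)) *
          ∏ i, (fun t => MaynardDense.profExt k t ^ 2) (MaynardDense.uOf R (e i)))) =
      if e ∈ dkBox L B R then
        P ^ 2 * ((((phiOmega L (∏ i, e i)) ^ 2)⁻¹ *
          (∏ p ∈ (∏ i, e i).primeFactors, (1 + 2 / ((p : ℝ) - 1))) ^ 2 *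
          ∏ p ∈ (∏ i, e i).primeFactors, ((p : ℝ) + 4 * ((k : ℝ) + 1) - 1)) *
          (MaynardDense.psi (∑ i, MaynardDense.uOf R (e i)) ^ 2 *
            ∏ i, MaynardDense.profExt k (MaynardDense.uOf R (e i)) ^ 2)) else 0 := by
    intro e he
    rw [rWeight_a3Fun_eq hadm he]
    split_ifs
    · simp only [zero_add]
    · rw [zero_mul, mul_zero]
  rw [Finset.sum_congr rfl hrw, ← Finset.sum_filter, Finset.filter_mem_eq_inter,
    Finset.inter_eq_right.2 (dkBox_subset_piFinset L B R)]
  refine Finset.sum_congr rfl fun r hr => ?_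
  have hr1 : ∀ i, 1 ≤ r i := one_le_of_mem_dkBox hr
  have hlogR : 0 < Real.log R := Real.log_pos hR
  have hu : ∀ i, MaynardDense.uOf R (r i) = Real.log (r i) / Real.log R := fun i => rfl
  have hu0 : ∀ i, 0 ≤ MaynardDense.uOf R (r i) := fun i =>
    div_nonneg (Real.log_nonneg (by exact_mod_cast hr1 i)) hlogR.le
  rw [yVar_eq_mul_F L B hR.le r hr1]
  unfold MaynardDense.F
  have hprof : ∀ i, MaynardDense.prof k (Real.log (r i) / Real.log R) =
      MaynardDense.profExt k (MaynardDense.uOf R (r i)) := fun i => by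
    rw [← hu i, MaynardDense.profExt_of_nonneg hk (hu0 i)]
  simp_rw [hprof, ← hu]
  rw [Finset.prod_pow, div_pow]
  ring

/-! ## §4 `Π_{A₃} ≤ 4⁹⁰ Π`: comparison of the Euler products -/

/-- **Termwise comparison** at a prime `p > 2k²`: `1 + n/A₃(p) ≤ (1 + 60k²/p²)(1 + n/(p − ω(p)))`
(`0 ≤ n ≤ k`): `n/A₃ = (n/a)·(p+1)²(p+4k+3)/(a(p−1)²)` with `a = p − ω(p) ≥ p − k`, and
`p (p+1)²(p+4k+3) ≤ (p + 30k)(p − k)(p − 1)²` for `p > 2k²`, so `n/A₃ ≤ (n/a)(1 + 30k/p)` and `n/a ≤ 2k/p`.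
[cite: Maynard2016DenseClusters, Lemma 8.4 (Π_g = ∏(1 + n(p)/g(p))(1 − 1/p)^r), proof of Prop. 9.4 p. 26] -/
theorem one_add_div_a3Fun_le (hk : 2 ≤ k) {L : Fin k → ℤ × ℤ} (hadm : FormsAdmissible L) {p : ℕ}
    (hp : p.Prime) (h2k : 2 * k ^ 2 < p) {n : ℝ} (hn0 : 0 ≤ n) (hnk : n ≤ k) :
    1 + n / a3Fun L p ≤ (1 + 60 * (k : ℝ) ^ 2 / (p : ℝ) ^ 2) * (1 + n / ((p : ℝ) - omegaL L p)) := by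
  have hkr : (2 : ℝ) ≤ k := by exact_mod_cast hk
  have hω : ((omegaL L p : ℕ) : ℝ) ≤ k := by exact_mod_cast omegaL_le_card_of_admissible hadm hp
  have ha0 : 0 < (p : ℝ) - omegaL L p := sub_omegaL_pos hadm hp
  have hω0 : (0 : ℝ) ≤ (omegaL L p : ℕ) := Nat.cast_nonneg _
  have hp2k : (2 : ℝ) * (k : ℝ) ^ 2 + 1 ≤ p := by
    have : 2 * k ^ 2 + 1 ≤ p := h2k
    exact_mod_cast this
  have hp2 : (2 : ℝ) ≤ p := by exact_mod_cast hp.two_le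
  set a : ℝ := (p : ℝ) - omegaL L p with ha
  have hkp : 2 * (k : ℝ) ≤ p := by nlinarith
  have hpk : (p : ℝ) - k ≤ a := by rw [ha]; linarith
  have hpk0 : 0 ≤ (p : ℝ) - k := by linarith
  have h2a : (p : ℝ) ≤ 2 * a := by rw [ha]; linarith
  have hp0 : (0 : ℝ) < p := by linarith
  have hp1 : (0 : ℝ) < (p : ℝ) - 1 := by linarith
  -- the polynomial inequality
  have hcub : (0 : ℝ) ≤ 50 * (k : ℝ) ^ 3 - 44 * (k : ℝ) ^ 2 - 41 * k - 13 := by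
    have : 50 * (k : ℝ) ^ 3 - 44 * (k : ℝ) ^ 2 - 41 * k - 13 =
        ((k : ℝ) - 2) * (50 * (k : ℝ) ^ 2 + 56 * k + 71) + 129 := by ring
    rw [this]
    have : 0 ≤ ((k : ℝ) - 2) * (50 * (k : ℝ) ^ 2 + 56 * k + 71) := mul_nonneg (by linarith) (by positivity)
    linarith
  have hpoly : (p : ℝ) * (((p : ℝ) + 1) ^ 2 * ((p : ℝ) + 4 * k + 3)) ≤
      ((p : ℝ) + 30 * k) * ((p : ℝ) - k) * ((p : ℝ) - 1) ^ 2 := by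
    have hid : ((p : ℝ) + 30 * k) * ((p : ℝ) - k) * ((p : ℝ) - 1) ^ 2 -
        (p : ℝ) * (((p : ℝ) + 1) ^ 2 * ((p : ℝ) + 4 * k + 3)) =
        (25 * (k : ℝ) - 7) * (p : ℝ) ^ 2 * ((p : ℝ) - (2 * (k : ℝ) ^ 2 + 1)) +
          (50 * (k : ℝ) ^ 3 - 44 * (k : ℝ) ^ 2 - 41 * k - 13) * (p : ℝ) ^ 2 +
          (60 * (k : ℝ) ^ 2 + 25 * k - 3) * ((p : ℝ) - 1) + (30 * (k : ℝ) ^ 2 + 25 * k - 3) := by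
      ring
    have h1 : 0 ≤ (25 * (k : ℝ) - 7) * (p : ℝ) ^ 2 * ((p : ℝ) - (2 * (k : ℝ) ^ 2 + 1)) :=
      mul_nonneg (mul_nonneg (by linarith) (sq_nonneg _)) (by linarith)
    have h2 : 0 ≤ (50 * (k : ℝ) ^ 3 - 44 * (k : ℝ) ^ 2 - 41 * k - 13) * (p : ℝ) ^ 2 :=
      mul_nonneg hcub (sq_nonneg _)
    have h3 : 0 ≤ (60 * (k : ℝ) ^ 2 + 25 * k - 3) * ((p : ℝ) - 1) := mul_nonneg (by nlinarith) hp1.le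
    have h4 : 0 ≤ 30 * (k : ℝ) ^ 2 + 25 * k - 3 := by nlinarith
    linarith
  -- `n/A₃ ≤ n (p + 30k)/(a p)`
  have hY : (0 : ℝ) < ((p : ℝ) + 1) ^ 2 * ((p : ℝ) + 4 * k + 3) := by positivity
  have hX : (0 : ℝ) < a ^ 2 * ((p : ℝ) - 1) ^ 2 := by positivity
  have hA3 : a3Fun L p = a ^ 2 * ((p : ℝ) - 1) ^ 2 / (((p : ℝ) + 1) ^ 2 * ((p : ℝ) + 4 * k + 3)) := by
    rw [a3Fun, ← ha]
  have hkey : n / a3Fun L p ≤ n * ((p : ℝ) + 30 * k) / (a * p) := by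
    rw [hA3, div_div_eq_mul_div, div_le_div_iff₀ hX (by positivity)]
    -- `n Y (a p) ≤ n (p + 30k) a² (p−1)²`
    have h1 : n * a * ((p : ℝ) * (((p : ℝ) + 1) ^ 2 * ((p : ℝ) + 4 * k + 3))) ≤
        n * a * (((p : ℝ) + 30 * k) * ((p : ℝ) - k) * ((p : ℝ) - 1) ^ 2) :=
      mul_le_mul_of_nonneg_left hpoly (mul_nonneg hn0 ha0.le)
    have h2 : n * a * (((p : ℝ) + 30 * k) * ((p : ℝ) - k) * ((p : ℝ) - 1) ^ 2) ≤
        n * a * (((p : ℝ) + 30 * k) * a * ((p : ℝ) - 1) ^ 2) := by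
      apply mul_le_mul_of_nonneg_left _ (mul_nonneg hn0 ha0.le)
      apply mul_le_mul_of_nonneg_right _ (sq_nonneg _)
      exact mul_le_mul_of_nonneg_left hpk (by linarith)
    calc n * (((p : ℝ) + 1) ^ 2 * ((p : ℝ) + 4 * k + 3)) * (a * p)
        = n * a * ((p : ℝ) * (((p : ℝ) + 1) ^ 2 * ((p : ℝ) + 4 * k + 3))) := by ring
      _ ≤ n * a * (((p : ℝ) + 30 * k) * a * ((p : ℝ) - 1) ^ 2) := h1.trans h2
      _ = n * ((p : ℝ) + 30 * k) * (a ^ 2 * ((p : ℝ) - 1) ^ 2) := by ring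
  -- `n (p + 30k)/(a p) = n/a + 30 k (n/(a p)) ≤ n/a + 60k²/p²`
  have hna : n / a ≤ 2 * k / p := by
    rw [div_le_div_iff₀ ha0 hp0]
    calc n * p ≤ k * (2 * a) := mul_le_mul hnk h2a hp0.le (by linarith)
      _ = 2 * k * a := by ring
  have hsplit : n * ((p : ℝ) + 30 * k) / (a * p) = n / a + 30 * k * (n / a) / p := by
    field_simp
  have hrest : 30 * k * (n / a) / p ≤ 60 * (k : ℝ) ^ 2 / (p : ℝ) ^ 2 := by
    rw [div_le_div_iff₀ hp0 (by positivity)]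
    calc 30 * k * (n / a) * (p : ℝ) ^ 2 ≤ 30 * k * (2 * k / p) * (p : ℝ) ^ 2 := by
          apply mul_le_mul_of_nonneg_right _ (sq_nonneg _)
          exact mul_le_mul_of_nonneg_left hna (by positivity)
      _ = 60 * (k : ℝ) ^ 2 * p := by field_simp; ring
  have hx : 0 ≤ 60 * (k : ℝ) ^ 2 / (p : ℝ) ^ 2 := by positivity
  have hy : 0 ≤ n / a := by positivity
  calc 1 + n / a3Fun L p ≤ 1 + (n / a + 60 * (k : ℝ) ^ 2 / (p : ℝ) ^ 2) := by
        rw [hsplit] at hkey; linarith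
    _ ≤ (1 + 60 * (k : ℝ) ^ 2 / (p : ℝ) ^ 2) * (1 + n / a) := by nlinarith [mul_nonneg hx hy]

/-- `∑_{2k² < p < y, p prime} 60k²/p² ≤ 90 log 4` (from `sum_ite_div_sq_le`). [cite: RosserSchoenfeld1962, Thm 9 (θ(x) < 2x log 2); Maynard2016DenseClusters, proof of Prop. 9.4 p. 26] -/
theorem sum_ite_sixty_div_sq_le (hk : 2 ≤ k) (y : ℕ) :
    ∑ p ∈ Nat.primesBelow y, (if 2 * k ^ 2 < p then 60 * (k : ℝ) ^ 2 / (p : ℝ) ^ 2 else 0) ≤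
      90 * Real.log 4 := by
  have h := sum_ite_div_sq_le hk y
  have heq : ∑ p ∈ Nat.primesBelow y, (if 2 * k ^ 2 < p then 60 * (k : ℝ) ^ 2 / (p : ℝ) ^ 2 else 0) =
      (15 / 2 : ℝ) * ∑ p ∈ Nat.primesBelow y,
        (if 2 * k ^ 2 < p then 8 * (k : ℝ) ^ 2 / (p : ℝ) ^ 2 else 0) := by
    rw [Finset.mul_sum]
    refine Finset.sum_congr rfl fun p _ => ?_
    split_ifs
    · ring
    · ring
  rw [heq]
  linarith

/-- **The partial Euler products compare**: `∏_{p<y}(1 + n(p)/A₃(p))(1 − 1/p)^k ≤ 4⁹⁰ ∏_{p<y}(1 + n(p)/(p − ω(p)))(1 − 1/p)^k`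
(`n(p) = 0` for `p ≤ 2k²`; `∏_{p > 2k²}(1 + 60k²/p²) ≤ e^{90 log 4}`).
[cite: Maynard2016DenseClusters, Lemma 8.4 (definition of Π_g), proof of Prop. 9.4 p. 26] -/
theorem piPartial_a3Fun_le (hk : 2 ≤ k) {L : Fin k → ℤ × ℤ} (hadm : FormsAdmissible L) (B : ℕ) (R : ℝ)
    (y : ℕ) :
    MaynardDense.piPartial k (idxMod L B R) (a3Fun L) y ≤
      (4 : ℝ) ^ 90 * MaynardDense.piPartial k (idxMod L B R) (fun p => (p : ℝ) - omegaL L p) y := by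
  classical
  unfold MaynardDense.piPartial
  set W := idxMod L B R with hW
  set c : ℕ → ℝ := fun p => if 2 * k ^ 2 < p then 1 + 60 * (k : ℝ) ^ 2 / (p : ℝ) ^ 2 else 1 with hc
  have hc1 : ∀ p, 1 ≤ c p := fun p => by
    by_cases h : 2 * k ^ 2 < p
    · rw [show c p = 1 + 60 * (k : ℝ) ^ 2 / (p : ℝ) ^ 2 from if_pos h]
      have : 0 ≤ 60 * (k : ℝ) ^ 2 / (p : ℝ) ^ 2 := by positivity
      linarith
    · rw [show c p = 1 from if_neg h]
  have hfac0 : ∀ p ∈ Nat.primesBelow y, 0 ≤ (1 - 1 / (p : ℝ)) ^ k := fun p hp => by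
    have hpp : p.Prime := (Nat.mem_primesBelow.1 hp).2
    have hp1 : (1 : ℝ) ≤ p := by exact_mod_cast hpp.one_lt.le
    exact pow_nonneg (by rw [sub_nonneg, div_le_one (by linarith)]; exact hp1) k
  have hterm : ∀ p ∈ Nat.primesBelow y,
      (1 + (MaynardDense.nW k W p : ℝ) / a3Fun L p) * (1 - 1 / (p : ℝ)) ^ k ≤
        c p * ((1 + (MaynardDense.nW k W p : ℝ) / ((p : ℝ) - omegaL L p)) * (1 - 1 / (p : ℝ)) ^ k) := by
    intro p hp
    have hpp : p.Prime := (Nat.mem_primesBelow.1 hp).2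
    have hq := hfac0 p hp
    by_cases h2k : 2 * k ^ 2 < p
    · rw [show c p = 1 + 60 * (k : ℝ) ^ 2 / (p : ℝ) ^ 2 from if_pos h2k]
      have hn0 : (0 : ℝ) ≤ MaynardDense.nW k W p := Nat.cast_nonneg _
      have hnk : (MaynardDense.nW k W p : ℝ) ≤ k := by exact_mod_cast nW_le W p
      have h := one_add_div_a3Fun_le hk hadm hpp h2k hn0 hnk
      calc (1 + (MaynardDense.nW k W p : ℝ) / a3Fun L p) * (1 - 1 / (p : ℝ)) ^ k
          ≤ ((1 + 60 * (k : ℝ) ^ 2 / (p : ℝ) ^ 2) *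
              (1 + (MaynardDense.nW k W p : ℝ) / ((p : ℝ) - omegaL L p))) * (1 - 1 / (p : ℝ)) ^ k :=
            mul_le_mul_of_nonneg_right h hq
        _ = _ := by ring
    · rw [not_lt] at h2k
      have hn : MaynardDense.nW k W p = 0 := by
        unfold MaynardDense.nW
        exact Finset.sum_eq_zero fun i _ => if_pos (hW ▸ dvd_idxMod_of_le L B R i hpp h2k)
      rw [show c p = 1 from if_neg (not_lt.2 h2k), hn]
      simp
  have hnonneg : ∀ p ∈ Nat.primesBelow y,
      0 ≤ (1 + (MaynardDense.nW k W p : ℝ) / a3Fun L p) * (1 - 1 / (p : ℝ)) ^ k := fun p hp =>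
    mul_nonneg (add_nonneg zero_le_one (div_nonneg (Nat.cast_nonneg _) (a3Fun_nonneg L p))) (hfac0 p hp)
  have hnonneg' : ∀ p ∈ Nat.primesBelow y,
      0 ≤ (1 + (MaynardDense.nW k W p : ℝ) / ((p : ℝ) - omegaL L p)) * (1 - 1 / (p : ℝ)) ^ k := fun p hp =>
    mul_nonneg (add_nonneg zero_le_one (div_nonneg (Nat.cast_nonneg _)
      (sub_omegaL_pos hadm (Nat.mem_primesBelow.1 hp).2).le)) (hfac0 p hp)
  have hcprod : ∏ p ∈ Nat.primesBelow y, c p ≤ (4 : ℝ) ^ 90 := by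
    have h1 : ∀ p ∈ Nat.primesBelow y,
        c p ≤ Real.exp (if 2 * k ^ 2 < p then 60 * (k : ℝ) ^ 2 / (p : ℝ) ^ 2 else 0) := by
      intro p _
      by_cases h : 2 * k ^ 2 < p
      · rw [show c p = 1 + 60 * (k : ℝ) ^ 2 / (p : ℝ) ^ 2 from if_pos h, if_pos h]
        have := Real.add_one_le_exp (60 * (k : ℝ) ^ 2 / (p : ℝ) ^ 2)
        linarith
      · rw [show c p = 1 from if_neg h, if_neg h, Real.exp_zero]
    have h90 : (90 : ℝ) * Real.log 4 = Real.log ((4 : ℝ) ^ 90) := by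
      rw [Real.log_pow]; norm_num
    calc ∏ p ∈ Nat.primesBelow y, c p
        ≤ ∏ p ∈ Nat.primesBelow y, Real.exp (if 2 * k ^ 2 < p then 60 * (k : ℝ) ^ 2 / (p : ℝ) ^ 2 else 0) :=
          Finset.prod_le_prod (fun p _ => zero_le_one.trans (hc1 p)) h1
      _ = Real.exp (∑ p ∈ Nat.primesBelow y,
            if 2 * k ^ 2 < p then 60 * (k : ℝ) ^ 2 / (p : ℝ) ^ 2 else 0) := by rw [Real.exp_sum]
      _ ≤ Real.exp (90 * Real.log 4) := Real.exp_le_exp.2 (sum_ite_sixty_div_sq_le hk y)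
      _ = (4 : ℝ) ^ 90 := by rw [h90, Real.exp_log (by positivity)]
  calc ∏ p ∈ Nat.primesBelow y, (1 + (MaynardDense.nW k W p : ℝ) / a3Fun L p) * (1 - 1 / (p : ℝ)) ^ k
      ≤ ∏ p ∈ Nat.primesBelow y,
          (c p * ((1 + (MaynardDense.nW k W p : ℝ) / ((p : ℝ) - omegaL L p)) * (1 - 1 / (p : ℝ)) ^ k)) :=
        Finset.prod_le_prod hnonneg hterm
    _ = (∏ p ∈ Nat.primesBelow y, c p) *
          ∏ p ∈ Nat.primesBelow y, ((1 + (MaynardDense.nW k W p : ℝ) / ((p : ℝ) - omegaL L p)) *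
            (1 - 1 / (p : ℝ)) ^ k) := Finset.prod_mul_distrib
    _ ≤ (4 : ℝ) ^ 90 * ∏ p ∈ Nat.primesBelow y,
          ((1 + (MaynardDense.nW k W p : ℝ) / ((p : ℝ) - omegaL L p)) * (1 - 1 / (p : ℝ)) ^ k) :=
        mul_le_mul_of_nonneg_right hcprod (Finset.prod_nonneg hnonneg')

/-- **`Π_{A₃} ≤ 4⁹⁰ Π`**: the constant of Lemma 8.4 for the weight `A₃` is at most `4⁹⁰` times the one for
`A = p − ω(p)` (both are the limits of their partial Euler products, `tendsto_piPartial_dec`; `k ≥ 8`).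
[cite: Maynard2016DenseClusters, Lemma 8.4 (Π_g), proof of Prop. 9.4 p. 26] -/
theorem piRec_a3Fun_le (hk : 8 ≤ k) {L : Fin k → ℤ × ℤ} (hadm : FormsAdmissible L) {B : ℕ} (hB : B ≠ 0)
    (R : ℝ) :
    MaynardDense.piRec k (idxMod L B R) (a3Fun L) ≤
      (4 : ℝ) ^ 90 * MaynardDense.piRec k (idxMod L B R) (fun p => (p : ℝ) - omegaL L p) := by
  have hk2 : 2 ≤ k := le_trans (by norm_num) hk
  have hk2r : (2 : ℝ) ≤ k := by exact_mod_cast hk2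
  have hT1 := MaynardDense.tendsto_piPartial_dec k (idxMod L B R) k ((k : ℝ) ^ 2) (a3Fun L) hk2r le_rfl
    (fun i => idxMod_ne_zero L hB R i) (fun i p hp hle => dvd_idxMod_of_real_le L B R i hp hle)
    (fun p hp => a3Fun_pos hadm hp) (fun p hp => abs_one_add_a3Fun_sub_le hk hadm hp)
  have hT2 := MaynardDense.tendsto_piPartial_dec k (idxMod L B R) k (2 * (k : ℝ) - 1)
    (fun p => (p : ℝ) - omegaL L p) hk2r (by nlinarith [sq_nonneg ((k : ℝ) - 1)])
    (fun i => idxMod_ne_zero L hB R i) (fun i p hp hle => dvd_idxMod_of_real_le L B R i hp hle)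
    (fun p hp => sub_omegaL_pos hadm hp) (fun p hp => abs_dev_omegaL_add_le hk2 hadm hp)
  exact le_of_tendsto_of_tendsto' hT1 (hT2.const_mul _) fun y => piPartial_a3Fun_le hk2 hadm B R y

/-! ## §5 `S_A ≪ P (log R)^k I_k(F)` in the frame of Proposition 6.1 -/

set_option maxHeartbeats 1600000 in
/-- **The `k`-dimensional sum of Prop. 9.4**: in the ranges of Prop. 6.1, for `k ≥ 2^18`,
`S_A = ∑_{g ∈ 𝒟_k}(y_g/φ_ω(g))² (∏_{p∣g}(1+2/(p−1)))² ∏_{p∣g}(p+4k+3) ≤ K · P · (log R)^k I_k(F)`,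
`P = (WB)^k 𝔖_{WB}(𝓛)/φ(WB)^k`: `S_A = P² Σ^{(k)}(W_j; A₃; ψ², g_k²)` (`sum_SA_eq_rFoldSum`), Lemma 8.4
(decoupled constants `K₀ = k`, `K₁ = k²`, `L ≤ 29 (log X)^{1/10}`, `Ω_G/I_G ≤ 3T_k²`) gives
`Σ^{(k)} ≤ 245 Π_{A₃} (log R)^k I_k(F)`, `Π_{A₃} ≤ 4⁹⁰ Π` and `P·Π = excProd ≤ 2` («the singular series cancel»).
Printed: the sum over `r ∈ 𝒟_k` is `O(𝔖_{WB}(𝓛)^{-1})` times `y_max² (log R)^k`.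
[cite: Maynard2016DenseClusters, proof of Prop. 9.4 p. 26, Lemma 8.4 p. 16, proof of Prop. 9.1 (9.4) p. 20; FordGreenKonyaginMaynardTao2018, Thm 6 (7.12) pp. 21–22] -/
theorem prop94_kdimSum_frame :
    ∃ (C : ℕ) (K : ℝ), 0 < K ∧ Prop61Frame C fun B k L _X R =>
      ∑ g ∈ dkBox L B R,
          (yVar L B R (MaynardDense.F k) g / phiOmega L (∏ i, g i)) ^ 2 *
            (∏ p ∈ (∏ j, g j).primeFactors, (1 + 2 / ((p : ℝ) - 1))) ^ 2 *
            ∏ p ∈ (∏ j, g j).primeFactors, ((p : ℝ) + 4 * ((k : ℝ) + 1) - 1) ≤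
        K * ((((wCut k B * B : ℕ) : ℝ) ^ k / (Nat.totient (wCut k B * B) : ℝ) ^ k *
              singSeriesExcl L (wCut k B * B)) * (Real.log R ^ k * MaynardDense.IF k)) := by
  obtain ⟨C84, hC0, h84⟩ := MaynardDense.lemma84_all'_dec
  set CE : ℝ := 20880 * C84 with hCE
  have hCE0 : 0 ≤ CE := by positivity
  refine ⟨262144, 490 * (4 : ℝ) ^ 90, by positivity, ?_⟩
  have hfr := prop91_excProd_frame
  unfold Prop61Frame at hfr ⊢
  filter_upwards [hfr, eventually_prop91_main_aux (CE + 1)] with x hxE hx B hB hBx k L X R hCk hk hadm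
    hnd hcoef hX1 hX2 hR1 hR2
  obtain ⟨E, hE1, hE, hlogE, -, hPiE, hex1, hex2⟩ :=
    hxE B hB hBx k L X R (le_trans (by norm_num) hCk) hk hadm hnd hcoef hX1 hX2 hR1 hR2
  obtain ⟨hXone, hlX1, hKbig, hk2X, hk3X, hlogXR, hR2'⟩ := hx k hk X R hX1 hR1
  have hk2 : 2 ≤ k := le_trans (by norm_num) hCk
  have hk8 : 8 ≤ k := le_trans (by norm_num) hCk
  have hk0 : (0 : ℝ) < k := by exact_mod_cast (show 0 < k by omega)
  have hB0 : B ≠ 0 := hB.elim (fun h => by rw [h]; exact one_ne_zero) fun h => h.ne_zero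
  have hlX0 : 0 < Real.log X := by linarith
  have hR1' : 1 < R := by linarith
  have hlogR : 0 < Real.log R := Real.log_pos hR1'
  -- abbreviations
  set W := wCut k B with hW
  set A : ℕ → ℝ := a3Fun L with hA
  set P : ℝ := ((W * B : ℕ) : ℝ) ^ k / (Nat.totient (W * B) : ℝ) ^ k * singSeriesExcl L (W * B) with hP
  set Pi : ℝ := MaynardDense.piRec k (idxMod L B R) (fun p => (p : ℝ) - omegaL L p) with hPi
  set Pi3 : ℝ := MaynardDense.piRec k (idxMod L B R) A with hPi3
  set S : ℝ := MaynardDense.rFoldSum k (idxMod L B R) A (fun x => MaynardDense.psi x ^ 2)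
    (fun t => MaynardDense.profExt k t ^ 2) R 0 with hS
  set LI : ℝ := Real.log R ^ k * MaynardDense.IF k with hLI
  set ex : ℝ := excProd L (W * B) ⌊R⌋₊ E with hex
  set u : ℝ := Real.log X ^ ((1 : ℝ) / 10) with hu
  -- positivity
  have hu1 : 1 ≤ u := Real.one_le_rpow hlX1 (by norm_num)
  have hu0 : 0 < u := by linarith
  have hIF : 0 < MaynardDense.IF k := MaynardDense.orthantI_F_pos hCk
  have hLI0 : 0 ≤ LI := by positivity
  have hSpos : 0 < singSeriesExcl L (W * B) := singSeriesExcl_pos_of_nondegenerate hadm hnd _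
  have hφpos : (0 : ℝ) < (Nat.totient (W * B) : ℝ) := by
    exact_mod_cast Nat.totient_pos.2 (Nat.pos_of_ne_zero (mul_ne_zero (wCut_ne_zero k B) hB0))
  have hWB0 : (0 : ℝ) < ((W * B : ℕ) : ℝ) := by
    exact_mod_cast Nat.pos_of_ne_zero (mul_ne_zero (wCut_ne_zero k B) hB0)
  have hP0 : 0 < P := by rw [hP]; positivity
  -- `S_A = P² S`
  have hSA := sum_SA_eq_rFoldSum hk2 hadm B hR1'
  rw [hSA]
  -- Lemma 8.4 for `A₃`
  obtain ⟨hG1, hG2, hG3, hG4, hG5, hG6, hG7⟩ := MaynardDense.lemma84_hypG_profExt_sq hk2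
  obtain ⟨hΦ1, hΦ2, hΦ3⟩ := MaynardDense.lemma84_hypPhi_psi_sq
  set Λ : ℝ := 29 * u with hΛ
  set Gs : ℝ := 2 * (1 + 30 / MaynardDense.U k + MaynardDense.T k) with hGs
  have hWi : ∀ i, idxMod L B R i ≤ W * B * E := fun i =>
    idxMod_le_mul_exceptional hadm B R i (by omega) hE
  have hBX : (B : ℝ) ≤ 2 * X := by
    have : (B : ℝ) ≤ x := by exact_mod_cast hBx
    linarith
  have hRX : R ≤ X := hR2.trans (Real.rpow_le_self_of_one_le hXone (by norm_num))
  have hΛhyp : ∀ i, ∀ M : ℕ, M ≠ 0 → (M : ℝ) ≤ (idxMod L B R i : ℝ) * (⌈R⌉₊ : ℝ) ^ k →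
      9 + ∑ p ∈ M.primeFactors, Real.log p / p ≤ Λ := fun i M hM hMle =>
    lambda84_le hk2 hB0 hXone hlX1 hk2X hBX hE1 hlogE hWi (by linarith) hRX i hM hMle
  have hGsb : Gs ≤ 3 * ((k : ℝ) * Real.log k) ^ 2 * MaynardDense.gam k := two_mul_Gs_le hCk
  have hkGs : (k : ℝ) * Gs ≤ 24 * Real.log X ^ ((4 : ℝ) / 5) * MaynardDense.gam k := by
    calc (k : ℝ) * Gs ≤ (k : ℝ) * (3 * ((k : ℝ) * Real.log k) ^ 2 * MaynardDense.gam k) :=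
          mul_le_mul_of_nonneg_left hGsb hk0.le
      _ = 3 * ((k : ℝ) ^ 3 * Real.log k ^ 2) * MaynardDense.gam k := by ring
      _ ≤ 3 * (8 * Real.log X ^ ((4 : ℝ) / 5)) * MaynardDense.gam k :=
          mul_le_mul_of_nonneg_right (mul_le_mul_of_nonneg_left hk3X (by norm_num)) hG7.le
      _ = 24 * Real.log X ^ ((4 : ℝ) / 5) * MaynardDense.gam k := by ring
  have huv : u * Real.log X ^ ((4 : ℝ) / 5) = Real.log X / u := by
    rw [eq_div_iff hu0.ne', hu, ← Real.rpow_add hlX0, ← Real.rpow_add hlX0]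
    norm_num
  have hkε : (k : ℝ) * (C84 * Λ * Gs / (MaynardDense.gam k * Real.log R)) ≤ CE / u := by
    have hden : 0 < MaynardDense.gam k * Real.log R := mul_pos hG7 hlogR
    rw [show (k : ℝ) * (C84 * Λ * Gs / (MaynardDense.gam k * Real.log R)) =
      C84 * Λ * ((k : ℝ) * Gs) / (MaynardDense.gam k * Real.log R) by ring]
    rw [div_le_iff₀ hden]
    calc C84 * Λ * ((k : ℝ) * Gs) ≤ C84 * Λ * (24 * Real.log X ^ ((4 : ℝ) / 5) * MaynardDense.gam k) :=
          mul_le_mul_of_nonneg_left hkGs (by positivity)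
      _ = 24 * 29 * C84 * (u * Real.log X ^ ((4 : ℝ) / 5)) * MaynardDense.gam k := by rw [hΛ]; ring
      _ = 24 * 29 * C84 * (Real.log X / u) * MaynardDense.gam k := by rw [huv]
      _ = CE / u * (MaynardDense.gam k * (Real.log X / 30)) := by rw [hCE]; ring
      _ ≤ CE / u * (MaynardDense.gam k * Real.log R) := by
          apply mul_le_mul_of_nonneg_left _ (by positivity)
          exact mul_le_mul_of_nonneg_left (by linarith) hG7.le
  have hkε1 : (k : ℝ) * (C84 * Λ * Gs / (MaynardDense.gam k * Real.log R)) ≤ 1 := by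
    refine hkε.trans ?_
    rw [div_le_one hu0]
    linarith
  have hk2r : (2 : ℝ) ≤ k := by exact_mod_cast hk2
  have h := h84 k (idxMod L B R) k ((k : ℝ) ^ 2) A (fun t => MaynardDense.profExt k t ^ 2)
    (fun x => MaynardDense.psi x ^ 2) Gs (MaynardDense.gam k) 1 60 Λ R 0 hk2r le_rfl
    (fun i => idxMod_ne_zero L hB0 R i)
    (fun i p hp hle => dvd_idxMod_of_real_le L B R i hp hle) (fun p hp => a3Fun_pos hadm hp)
    (fun p hp => abs_one_add_a3Fun_sub_le hk8 hadm hp) hG1 hG2 hG3 hG4 hG5 hG6 hG7 hΦ1 hΦ2 hΦ3 hR2'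
    hΛhyp hkε1
  obtain ⟨hPi30, hbd⟩ := h
  rw [MaynardDense.orthInt_profExt_sq_psi_sq hk2] at hbd
  -- `γ^k ≤ 2 I_k(F)`
  have hgamIF : MaynardDense.gam k ^ k ≤ 2 * MaynardDense.IF k := by
    have := MaynardDense.orthantI_F_ge_half hCk
    rw [MaynardDense.IF]; linarith
  set kε : ℝ := (k : ℝ) * (C84 * Λ * Gs / (MaynardDense.gam k * Real.log R)) with hkεdef
  have hkε0 : 0 ≤ kε := by
    rw [hkεdef]
    have hGs0 : 0 ≤ Gs := le_trans (by positivity) (hG5 0 ⟨le_rfl, zero_le_one⟩)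
    positivity
  -- `S ≤ 245 Π₃ LI`
  have hS1 : S ≤ 245 * (Pi3 * LI) := by
    have h1 : |S - Pi3 * LI| ≤ 2 * kε * (Pi3 * Real.log R ^ k * MaynardDense.gam k ^ k * (1 + 60)) := by
      rw [hLI, ← mul_assoc]; exact hbd
    have h2 : Pi3 * Real.log R ^ k * MaynardDense.gam k ^ k ≤ Pi3 * Real.log R ^ k * (2 * MaynardDense.IF k) :=
      mul_le_mul_of_nonneg_left hgamIF (by positivity)
    have h3 : 2 * kε * (Pi3 * Real.log R ^ k * MaynardDense.gam k ^ k * (1 + 60)) ≤ 244 * (Pi3 * LI) := by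
      calc 2 * kε * (Pi3 * Real.log R ^ k * MaynardDense.gam k ^ k * (1 + 60))
          ≤ 2 * kε * (Pi3 * Real.log R ^ k * (2 * MaynardDense.IF k) * (1 + 60)) := by
            apply mul_le_mul_of_nonneg_left _ (by positivity)
            exact mul_le_mul_of_nonneg_right h2 (by norm_num)
        _ = 244 * kε * (Pi3 * LI) := by rw [hLI]; ring
        _ ≤ 244 * 1 * (Pi3 * LI) := by
            apply mul_le_mul_of_nonneg_right _ (by positivity)
            exact mul_le_mul_of_nonneg_left hkε1 (by norm_num)
        _ = 244 * (Pi3 * LI) := by ring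
    have h4 := (abs_le.1 (h1.trans h3)).2
    linarith
  -- `Π₃ ≤ 4⁹⁰ Π`, `P Π = excProd ≤ 2`
  have hPi3le : Pi3 ≤ (4 : ℝ) ^ 90 * Pi := piRec_a3Fun_le hk8 hadm hB0 R
  have hPPi : P * Pi = ex := hPiE
  have hexle : ex ≤ 2 := by
    have : 1 / Real.log X ≤ 1 := by rw [div_le_one hlX0]; exact hlX1
    linarith
  calc P ^ 2 * S ≤ P ^ 2 * (245 * (Pi3 * LI)) := mul_le_mul_of_nonneg_left hS1 (sq_nonneg _)
    _ ≤ P ^ 2 * (245 * ((4 : ℝ) ^ 90 * Pi * LI)) := by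
        apply mul_le_mul_of_nonneg_left _ (sq_nonneg _)
        exact mul_le_mul_of_nonneg_left (mul_le_mul_of_nonneg_right hPi3le hLI0) (by norm_num)
    _ = 245 * (4 : ℝ) ^ 90 * (P * Pi) * (P * LI) := by ring
    _ ≤ 245 * (4 : ℝ) ^ 90 * 2 * (P * LI) := by
        apply mul_le_mul_of_nonneg_right _ (mul_nonneg hP0.le hLI0)
        rw [hPPi]
        exact mul_le_mul_of_nonneg_left hexle (by positivity)
    _ = 490 * (4 : ℝ) ^ 90 * (P * LI) := by ring

end Literature.NumberTheory.Sieve.FGKMT2018
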